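import Summits.QuantumFields.YangMills.Theorems.FluctuationComparisonRegPrIntLS2BetaResidualNearOfStabiliserLift
import HarnessLib

/-!
# S2β · POS∘ — (T7-red, II) POS∘ ∕ TUBE♭ AT PRINT'S REGULAR MINIMISER FROM ORBIT GROWTH **AT EVERY DATUM WHOSE SYMMETRIES LIFT TO IT**:
# seam (b) on the REDUCIBLE stratum — per-datum letters {`hlift`(V,U₀), (Lπ)_loc} in place of (T7b)'s {IRR(V), (Lπ)_loc}

Cell `ym3-torus` (YM ladder rung R3 = continuum `SU(2)` Yang–Mills on the three-torus at fixed lattice data — a RUNG: NOT d = 4, NOT infinite volume,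
NOT a mass gap, NOT Clay).  Width seat `ym3-torus-px8` (gen 19), the (T)-chain of LINE g18-1 S2β, seam (b).  Crux `stmt-QuantumFields-20520`
(`…Theses.UnitScaleTilt.FluctuationComparisonRegPrIntL`); `--kind proof --supports stmt-QuantumFields-20520 --as helper`, count-neutral, DEFINITION-FREE
(0 `def`, 0 `instance`, 0 `notation`, 0 `sorry`, default heartbeats).

WHAT.  ✓(T7b) `…S2BetaPosCollarAtIrreducible` §5's three theorems with the binder IRR(V) (scalar commutant) REPLACED by ✓px17 pen 4's LIFTING HYPOTHESIS at the base point,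
`hlift : ∀ s, s • V = V → ∃ k, k • U₀ = U₀ ∧ k↓ = s` (`…S2BetaCriticalOrbitUnique.sameOrbit_of_symmetriesLift_five` :212–213 at `U₀`, α-renamed `n ↦ J`, `hnK.le ↦ hJK.le`) — every
other binder and all three conclusions ((T4) §1's growth socket, px8's POS∘ `hpos`, TUBE♭) BYTE-IDENTICAL to (T7b); proofs = (T7b)'s with ✓`exists_near_stabiliser` (zero hypotheses)
for `exists_near_scalar_of_irr hirr` and (T7-red, I) ✓`exists_residual_near_of_near_orbit_of_lift` for (T7b) §4:
* ★★★ `growthOn_nhds_at_isCritR2_of_lift_five` · ★★★ `posCollar_at_isCritR2_of_lift_five` · ★★★ `tubeGrowth_at_isCritR2_of_lift_of_isolated_five`.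
WHAT IT DOES FOR THE SEAM: POS∘∕TUBE♭ per datum at `L ≥ 5` at EVERY datum ⟸ {`hlift`(V,U₀), (Lπ)_loc at `U₀` (✓px13 `…S2BetaDescentLipschitz`), ISOL∘(δ) (TUBE♭ only)} — NO irreducibility,
NO (E), NO (Ls), NO moved-datum minimiser; `hlift` is the ONE displayed token, shared with the ISOL∘ side (pen 4 ∕ ✓px8 `isol_of_atMostOneCriticalOrbit`); it holds trivially on the
central-stabiliser stratum ((T7-red, I) §2 — so (T7b) is the special case), and is supplied at case-A abelian data by ⧗px12 (B) `…S2BetaAbelianSymmetricCriticality` (⟸ EX^{ab}).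
CONSTANTS PER DATUM (existential), as POS∘ is; `e₈(L)` is pen 3's.

HONEST: composition over landed theorems; nothing of Bałaban's analysis beyond the cited tree theorems; `hlift` at reducible data, ISOL∘(δ), TUBE-REG∘ (datum-free δ, K-uniform μ in the organ's
quantifier order), GAP♯∘, GAP♭, EXW∘, S2β, crux 20520 NOT proved; at `L = 3` pen 3's Thm-2 socket is open (EMBARGO-LITE №58); no summit statement is proved by a helper; finite-volume ∕
conditional; rung R3 = SU(2) YM₃ on T³ — NOT d = 4, NOT infinite volume, NOT a mass gap, NOT Clay; the Yang–Mills mass gap is NOT proved.  Sorry-free, axioms standard.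

References: T. Bałaban, CMP **102** (1985) 277–309 [Balaban1985Variational] ((4)–(6) p.278, Thm 1 (8)–(10) p.279, Prop. 7 and (141)–(143) p.299); CMP **102** (1985) 255–275 [Balaban1985UV3]
((12)–(13) p.259, (18)–(22) p.260); CMP **98** (1985) 17–51 [Balaban1985Averaging] ((8), (11)–(13) p.19, Prop. 5 (156)–(157) p.42); CMP **99** (1985) 75–102 [Balaban1985RegularSpaces] (Thm 2 p.83).
-/

set_option autoImplicit false

noncomputable section

namespace Summit.QuantumFields.YangMills.Theorems.FluctuationComparisonRegPrIntLS2BetaPosCollarOfStabiliserLift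



open Set Filter Topology Function
open scoped Matrix.Norms.L2Operator
open Literature.MathematicalPhysics.QuantumFieldTheory.Balaban1983to89
open Literature.MathematicalPhysics.QuantumFieldTheory.Balaban1983to89.T3ContinuumYM3Torus
open Literature.MathematicalPhysics.QuantumFieldTheory.Balaban1983to89.T3UnitLawDensityEML (ℰp)
open Literature.MathematicalPhysics.QuantumFieldTheory.Balaban1983to89.T3UnitScaleTilt
open Literature.MathematicalPhysics.QuantumFieldTheory.Balaban1983to89.T3TiltDescent
open Literature.MathematicalPhysics.QuantumFieldTheory.Balaban1983to89.T3ConstrainedMinimiser (fibre)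
open Literature.MathematicalPhysics.QuantumFieldTheory.Balaban1983to89.T3PrintedRegularMinimiser
open Literature.MathematicalPhysics.QuantumFieldTheory.Balaban1983to89.T3PrintedRegularOrbits (descTransf descendTo_gaugeAct liftTransfTo descTransf_liftTransfTo)
open Literature.MathematicalPhysics.QuantumFieldTheory.Balaban1983to89.T3Thm1CarrierNative (IsCritR2)
open Literature.MathematicalPhysics.QuantumFieldTheory.Balaban1983to89.T4Continuum
open scoped Literature.MathematicalPhysics.QuantumFieldTheory.Balaban1983to89.T3OrbitAverage
open Summit.QuantumFields.YangMills.Theorems.FluctuationComparisonRegPrIntLS2BetaResidualGauge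
open Summit.QuantumFields.YangMills.Theorems.FluctuationComparisonRegPrIntLS2BetaPosCollarOfGrowthRow (iInf_orbitDistSq_gaugeAct_left iInf_orbitDistSq_le_sum_one)
open Summit.QuantumFields.YangMills.Theorems.FluctuationComparisonRegPrIntLS2BetaPosCollarCoverOfTubeChart (mem_fibre_of_mem_closure_of_continuousAt)
open Summit.QuantumFields.YangMills.Theorems.FluctuationComparisonRegPrIntLS2BetaPosCollarOfLocalGrowth
open Summit.QuantumFields.YangMills.Theorems.FluctuationComparisonRegPrIntLS2BetaOrbitDistComparison (sum_dist1_sq_gaugeAct sum_dist1_sq_comm sqrt_sum_dist1_sq_triangle)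
open Summit.QuantumFields.YangMills.Theorems.FluctuationComparisonRegPrIntLS2BetaOrbitGrowthOfRegular (orbitGrowth_of_isCritR2_five)
open Summit.QuantumFields.YangMills.Theorems.Prop7CritEL (isOpen_regPr)
open Summit.QuantumFields.YangMills.Theorems.FluctuationComparisonRegPrIntLS2BetaSignedCombLipschitz (dist1_mul_inv_eq_norm_sub)
open Summit.QuantumFields.YangMills.Theorems.FluctuationComparisonRegPrIntLS2BetaNearSymmetryRigidity
open Summit.QuantumFields.YangMills.Theorems.FluctuationComparisonRegPrIntLS2BetaNearStabiliserRigidity (exists_near_stabiliser)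

open Summit.QuantumFields.YangMills.Theorems.FluctuationComparisonRegPrIntLS2BetaResidualNearOfStabiliserLift (exists_residual_near_of_near_orbit_of_lift)

/-! ## §1 Intrinsic local growth, POS∘ and TUBE♭ at print's regular minimiser over ANY datum whose symmetries lift to it -/

section Assembly

/-- ★★★ **INTRINSIC LOCAL GROWTH AT PRINT'S REGULAR MINIMISER OVER ANY DATUM WHOSE SYMMETRIES LIFT TO IT, FROM ORBIT GROWTH — (T4) §1's socket filled per datum at every `L ≥ 5`;
the reducible-stratum edition of ✓(T7b) `growthOn_nhds_at_isCritR2_of_irr_five` (binder IRR(V) ↦ pen 4's `hlift` at `U₀`; everything else VERBATIM).**  For every block size `L ≥ 5` there is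
`e₈ > 0` (pen 3's) such that: at every member `(F, J < K)`, every datum `V`, every base point `U₀ ∈ regFibrePr e V` (`0 < e ≤ e₈`) that is R2-critical and realises `minActionRegPr ε₀ V`,
with `descendTo` continuous near `U₀` ((T2d)), every symmetry of `V` lifting to a symmetry of `U₀` (`hlift`), and the descent LIPSCHITZ AT `U₀` in J5's sup-norm letter shape ((Lπ)_loc),
there are a neighbourhood `N` of `U₀` and `c > 0` with `c·⨅_{w residual} Σ_ℓ dist1 (U ℓ·((w•U₀) ℓ)⁻¹)² ≤ A U − minActionRegPr ε₀ V` for every `U ∈ N ∩ closure (fibre V ∩ histGood)`.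
MECHANISM: pen 3 ✓`orbitGrowth_of_isCritR2_five` gives a FINE `u` with `c·ℓ⁻²·d(U,u•U₀)² ≤ A U − A U₀`; (T7-red, I) (near-STABILISER rigidity ✓`exists_near_stabiliser` + `hlift`) turns it into a
RESIDUAL `w` with `d(w•U, U₀) ≤ M·d(U, u•U₀)`; the residual-orbit distance inherits pen 3's row with `c ↦ c·ℓ⁻²∕M²`.  Constants PER DATUM; NO irreducibility, NO (E), NO (Ls).
[cite: Balaban1985Variational, Thm 1 (8)-(10) p.279, (141)-(143) p.299, (4) p.278; Balaban1985Averaging, (8) p.19, (11)-(13) p.19, Prop. 5 (157) p.42; Balaban1985RegularSpaces, Thm 2 p.83] -/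
theorem growthOn_nhds_at_isCritR2_of_lift_five (L : ℕ) (h5 : 5 ≤ L) :
    ∃ e₈ : ℝ, 0 < e₈ ∧
      ∀ (F : T3Family), F.L = L → ∀ (J K : ℕ) (hJK : J < K) (e γ b₀ p₀ ε₀ : ℝ)
        (V : GaugeField (F.P J) 0 (Matrix.specialUnitaryGroup (Fin 2) ℂ)) (U₀ : GaugeField (F.P K) 0 (Matrix.specialUnitaryGroup (Fin 2) ℂ)),
        0 < e → e ≤ e₈ → U₀ ∈ regFibrePr F J K hJK.le e V → IsCritR2 F J K hJK.le V U₀ →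
        wilsonAction4 U₀ = minActionRegPr F J K hJK.le ε₀ V →
        (∀ᶠ W in 𝓝 U₀, ContinuousAt (descendTo F ℰp J K hJK.le) W) →
        (∀ s : GaugeTransf (F.P J) 0 (Matrix.specialUnitaryGroup (Fin 2) ℂ), GaugeField.gaugeAct s V = V →
            ∃ k : GaugeTransf (F.P K) 0 (Matrix.specialUnitaryGroup (Fin 2) ℂ), GaugeField.gaugeAct k U₀ = U₀ ∧ descTransf F J K hJK.le k = s) →
        ∀ (ρ₀ Kπ : ℝ), 0 < ρ₀ → 0 ≤ Kπ →
        (∀ (B : GaugeField (F.P K) 0 (Matrix.specialUnitaryGroup (Fin 2) ℂ)) (ρ : ℝ), 0 ≤ ρ → ρ ≤ ρ₀ →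
          (∀ ℓ : PBond (F.P K) 0, ‖(U₀ ℓ : Matrix (Fin 2) (Fin 2) ℂ) - (B ℓ : Matrix (Fin 2) (Fin 2) ℂ)‖ ≤ ρ) →
          ∀ b : PBond (F.P J) 0,
            ‖((descendTo F ℰp J K hJK.le U₀ b : Matrix.specialUnitaryGroup (Fin 2) ℂ) : Matrix (Fin 2) (Fin 2) ℂ) -
                ((descendTo F ℰp J K hJK.le B b : Matrix.specialUnitaryGroup (Fin 2) ℂ) : Matrix (Fin 2) (Fin 2) ℂ)‖ ≤ Kπ * ρ) →
        ∃ N ∈ 𝓝 U₀, ∃ c : ℝ, 0 < c ∧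
          ∀ U ∈ closure (fibre F ℰp J K hJK.le V ∩ histGood F ℰp (θBal F.L γ b₀ p₀) K J), U ∈ N →
            c * (⨅ w : {w : Site (F.P K) 0 → Matrix.specialUnitaryGroup (Fin 2) ℂ |
                  ∀ U : GaugeField (F.P K) 0 (Matrix.specialUnitaryGroup (Fin 2) ℂ),
                    descendTo F ℰp J K hJK.le (GaugeField.gaugeAct w U) = descendTo F ℰp J K hJK.le U},
                ∑ ℓ : PBond (F.P K) 0,
                  dist1 (U ℓ * ((GaugeField.gaugeAct (w : Site (F.P K) 0 → Matrix.specialUnitaryGroup (Fin 2) ℂ) U₀) ℓ)⁻¹) ^ 2)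
              ≤ wilsonAction4 U - minActionRegPr F J K hJK.le ε₀ V := by
  obtain ⟨e₈, c, he₈, hc, HG⟩ := orbitGrowth_of_isCritR2_five L h5
  refine ⟨e₈, he₈, ?_⟩
  intro F hF J K hJK e γ b₀ p₀ ε₀ V U₀ he heε hU₀reg hcrit hmin hcont hlift ρ₀ Kπ hρ₀ hKπ hLip
  -- per-datum constants
  obtain ⟨KV, hKV, HR⟩ := exists_near_stabiliser V
  have hL1 : (1 : ℝ) < (F.L : ℝ) := by have := F.hL.2; exact_mod_cast (by omega : 1 < F.L)
  obtain ⟨cℓ, hcℓ⟩ : ∃ cℓ : ℝ, cℓ = c * (((F.L : ℝ) ^ (K - J)) ^ 2)⁻¹ := ⟨_, rfl⟩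
  have hcℓ0 : 0 < cℓ := by rw [hcℓ]; exact mul_pos hc (inv_pos.mpr (by positivity))
  obtain ⟨M, hM⟩ : ∃ M : ℝ, M = 1 + 2 * Real.sqrt (Fintype.card (PBond (F.P K) 0) : ℝ) *
      (KV * (Real.sqrt (Fintype.card (PBond (F.P J) 0) : ℝ) * Kπ)) := ⟨_, rfl⟩
  have hM0 : 0 < M := by
    have : 0 ≤ 2 * Real.sqrt (Fintype.card (PBond (F.P K) 0) : ℝ) * (KV * (Real.sqrt (Fintype.card (PBond (F.P J) 0) : ℝ) * Kπ)) := by positivity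
    rw [hM]; linarith
  -- the neighbourhood: regular ∩ continuity of the descent ∩ small action increment
  have hU₀fib : U₀ ∈ fibre F ℰp J K hJK.le V := ((mem_regFibrePr_iff F).1 hU₀reg).1
  have hU₀V : descendTo F ℰp J K hJK.le U₀ = V := hU₀fib
  have hreg0 : U₀ ∈ {U : GaugeField (F.P K) 0 (Matrix.specialUnitaryGroup (Fin 2) ℂ) | RegPr F J K e U} := ((mem_regFibrePr_iff F).1 hU₀reg).2
  have hAopen : IsOpen {U : GaugeField (F.P K) 0 (Matrix.specialUnitaryGroup (Fin 2) ℂ) | wilsonAction4 U < wilsonAction4 U₀ + cℓ * ρ₀ ^ 2} :=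
    isOpen_lt (B16Thm1BaseAtRecord11.continuous_wilsonAction4_SU (N := 2) (F.P K) 0) continuous_const
  have hA0 : U₀ ∈ {U : GaugeField (F.P K) 0 (Matrix.specialUnitaryGroup (Fin 2) ℂ) | wilsonAction4 U < wilsonAction4 U₀ + cℓ * ρ₀ ^ 2} := by
    show wilsonAction4 U₀ < wilsonAction4 U₀ + cℓ * ρ₀ ^ 2
    have : 0 < cℓ * ρ₀ ^ 2 := by positivity
    linarith
  have hN : ({U : GaugeField (F.P K) 0 (Matrix.specialUnitaryGroup (Fin 2) ℂ) | RegPr F J K e U} ∩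
      {W | ContinuousAt (descendTo F ℰp J K hJK.le) W} ∩
      {U | wilsonAction4 U < wilsonAction4 U₀ + cℓ * ρ₀ ^ 2}) ∈ 𝓝 U₀ :=
    inter_mem (inter_mem ((isOpen_regPr F J K e).mem_nhds hreg0) hcont) (hAopen.mem_nhds hA0)
  refine ⟨_, hN, cℓ / M ^ 2, div_pos hcℓ0 (by positivity), ?_⟩
  intro U hUcl hUN
  obtain ⟨⟨hUreg', hUcont⟩, hUA⟩ := hUN
  -- a near point of the closed good fibre is a regular competitor
  have hUf : U ∈ fibre F ℰp J K hJK.le V := mem_fibre_of_mem_closure_of_continuousAt F hJK.le (closure_mono inter_subset_left hUcl) hUcont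
  have hUV : descendTo F ℰp J K hJK.le U = V := hUf
  have hUreg : U ∈ regFibrePr F J K hJK.le e V := (mem_regFibrePr_iff F).2 ⟨hUf, hUreg'⟩
  -- pen 3: the fine gauge `u` and the growth row
  obtain ⟨u, hgrow⟩ := HG F hF J K hJK e V U₀ he heε hU₀reg hcrit U hUreg
  obtain ⟨ρsq, hρsq⟩ : ∃ ρsq : ℝ, ρsq = ∑ ℓ : PBond (F.P K) 0, dist1 (U ℓ * ((GaugeField.gaugeAct u U₀) ℓ)⁻¹) ^ 2 := ⟨_, rfl⟩
  have hρsq0 : 0 ≤ ρsq := by rw [hρsq]; exact Finset.sum_nonneg fun ℓ _ => sq_nonneg _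
  obtain ⟨ρ, hρ⟩ : ∃ ρ : ℝ, ρ = Real.sqrt ρsq := ⟨_, rfl⟩
  have hρ0 : 0 ≤ ρ := by rw [hρ]; exact Real.sqrt_nonneg _
  have hρ2 : ρ ^ 2 = ρsq := by rw [hρ]; exact Real.sq_sqrt hρsq0
  have hgrow' : cℓ * ρsq ≤ wilsonAction4 U - wilsonAction4 U₀ := by rw [hcℓ, hρsq]; exact hgrow
  -- `ρ ≤ ρ₀` from the small action increment
  have hρρ₀ : ρ ≤ ρ₀ := by
    have h1 : cℓ * ρsq < cℓ * ρ₀ ^ 2 := by have := hUA.out; linarith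
    have h2 : ρsq < ρ₀ ^ 2 := lt_of_mul_lt_mul_left h1 hcℓ0.le
    have h3 : ρ ^ 2 < ρ₀ ^ 2 := by rw [hρ2]; exact h2
    exact le_of_lt (by nlinarith [hρ0, hρ₀])
  -- §4: a residual `w` with `d(w•U, U₀) ≤ M·ρ`
  obtain ⟨w, hwres, hdist⟩ := exists_residual_near_of_near_orbit_of_lift F hJK.le V U₀ U hU₀V hUV hKV HR hlift hKπ hLip
    (u : Site (F.P K) 0 → Matrix.specialUnitaryGroup (Fin 2) ℂ) hρ0 hρρ₀ (by rw [hρ2, hρsq])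
  rw [← hM] at hdist
  -- the residual-orbit distance of `U` to `U₀` is at most `(M·ρ)²`
  have hD : (⨅ w' : {w : Site (F.P K) 0 → Matrix.specialUnitaryGroup (Fin 2) ℂ |
        ∀ U : GaugeField (F.P K) 0 (Matrix.specialUnitaryGroup (Fin 2) ℂ),
          descendTo F ℰp J K hJK.le (GaugeField.gaugeAct w U) = descendTo F ℰp J K hJK.le U},
      ∑ ℓ : PBond (F.P K) 0,
        dist1 (U ℓ * ((GaugeField.gaugeAct (w' : Site (F.P K) 0 → Matrix.specialUnitaryGroup (Fin 2) ℂ) U₀) ℓ)⁻¹) ^ 2) ≤ (M * ρ) ^ 2 := by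
    rw [← iInf_orbitDistSq_gaugeAct_left F hJK.le hwres U U₀]
    refine (iInf_orbitDistSq_le_sum_one F hJK.le _ _).trans ?_
    obtain ⟨S, hS⟩ : ∃ S : ℝ, S = ∑ ℓ : PBond (F.P K) 0, dist1 ((GaugeField.gaugeAct w U) ℓ * (U₀ ℓ)⁻¹) ^ 2 := ⟨_, rfl⟩
    rw [← hS] at hdist ⊢
    have h0 : 0 ≤ S := by rw [hS]; exact Finset.sum_nonneg fun ℓ _ => sq_nonneg _
    calc S = Real.sqrt S ^ 2 := (Real.sq_sqrt h0).symm
      _ ≤ (M * ρ) ^ 2 := pow_le_pow_left₀ (Real.sqrt_nonneg _) hdist 2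
  -- conclusion
  rw [← hmin]
  calc cℓ / M ^ 2 * (⨅ w' : {w : Site (F.P K) 0 → Matrix.specialUnitaryGroup (Fin 2) ℂ |
          ∀ U : GaugeField (F.P K) 0 (Matrix.specialUnitaryGroup (Fin 2) ℂ),
            descendTo F ℰp J K hJK.le (GaugeField.gaugeAct w U) = descendTo F ℰp J K hJK.le U},
        ∑ ℓ : PBond (F.P K) 0,
          dist1 (U ℓ * ((GaugeField.gaugeAct (w' : Site (F.P K) 0 → Matrix.specialUnitaryGroup (Fin 2) ℂ) U₀) ℓ)⁻¹) ^ 2)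
      ≤ cℓ / M ^ 2 * (M * ρ) ^ 2 := mul_le_mul_of_nonneg_left hD (div_nonneg hcℓ0.le (by positivity))
    _ = cℓ * ρsq := by rw [mul_pow, hρ2]; field_simp
    _ ≤ wilsonAction4 U - wilsonAction4 U₀ := hgrow'

/-- ★★★ **POS∘ AT PRINT'S REGULAR MINIMISER OVER AN IRREDUCIBLE DATUM, FROM ORBIT GROWTH** — ✓(T4) §1 `posCollar_of_growthOn_nhds` ∘ `growthOn_nhds_at_isCritR2_of_lift_five`.  Same `e₈(L)`;
at every member, irreducible datum `V`, R2-critical `U₀ ∈ regFibrePr e V` realising `minActionRegPr ε₀ V` with `descendTo` continuous near and Lipschitz at `U₀`, px8's POS∘ letter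
(`hpos` of ✓`tubeGrowth_of_pos_of_isolated`, (T3) VERBATIM) holds for every tube radius `δ`.  Seam (b) closes here WITHOUT (E) and WITHOUT (Ls): per-datum letters = {IRR(V), (Lπ)_loc}.
[cite: Balaban1985Variational, Thm 1 (8)-(10) p.279, (141)-(143) p.299; Balaban1985UV3, (12)-(13) p.259; Balaban1985Averaging, Prop. 5 (157) p.42] -/
theorem posCollar_at_isCritR2_of_lift_five (L : ℕ) (h5 : 5 ≤ L) :
    ∃ e₈ : ℝ, 0 < e₈ ∧
      ∀ (F : T3Family), F.L = L → ∀ (J K : ℕ) (hJK : J < K) (e γ b₀ p₀ ε₀ : ℝ)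
        (V : GaugeField (F.P J) 0 (Matrix.specialUnitaryGroup (Fin 2) ℂ)) (U₀ : GaugeField (F.P K) 0 (Matrix.specialUnitaryGroup (Fin 2) ℂ)) (δ : ℝ),
        0 < e → e ≤ e₈ → U₀ ∈ regFibrePr F J K hJK.le e V → IsCritR2 F J K hJK.le V U₀ →
        wilsonAction4 U₀ = minActionRegPr F J K hJK.le ε₀ V →
        (∀ᶠ W in 𝓝 U₀, ContinuousAt (descendTo F ℰp J K hJK.le) W) →
        (∀ s : GaugeTransf (F.P J) 0 (Matrix.specialUnitaryGroup (Fin 2) ℂ), GaugeField.gaugeAct s V = V →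
            ∃ k : GaugeTransf (F.P K) 0 (Matrix.specialUnitaryGroup (Fin 2) ℂ), GaugeField.gaugeAct k U₀ = U₀ ∧ descTransf F J K hJK.le k = s) →
        ∀ (ρ₀ Kπ : ℝ), 0 < ρ₀ → 0 ≤ Kπ →
        (∀ (B : GaugeField (F.P K) 0 (Matrix.specialUnitaryGroup (Fin 2) ℂ)) (ρ : ℝ), 0 ≤ ρ → ρ ≤ ρ₀ →
          (∀ ℓ : PBond (F.P K) 0, ‖(U₀ ℓ : Matrix (Fin 2) (Fin 2) ℂ) - (B ℓ : Matrix (Fin 2) (Fin 2) ℂ)‖ ≤ ρ) →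
          ∀ b : PBond (F.P J) 0,
            ‖((descendTo F ℰp J K hJK.le U₀ b : Matrix.specialUnitaryGroup (Fin 2) ℂ) : Matrix (Fin 2) (Fin 2) ℂ) -
                ((descendTo F ℰp J K hJK.le B b : Matrix.specialUnitaryGroup (Fin 2) ℂ) : Matrix (Fin 2) (Fin 2) ℂ)‖ ≤ Kπ * ρ) →
        ∃ r c : ℝ, 0 < r ∧ 0 < c ∧
          ∀ U ∈ closure (fibre F ℰp J K hJK.le V ∩ histGood F ℰp (θBal F.L γ b₀ p₀) K J),
            (∃ w : Site (F.P K) 0 → Matrix.specialUnitaryGroup (Fin 2) ℂ,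
              (∀ U'' : GaugeField (F.P K) 0 (Matrix.specialUnitaryGroup (Fin 2) ℂ),
                  descendTo F ℰp J K hJK.le (GaugeField.gaugeAct w U'') = descendTo F ℰp J K hJK.le U'') ∧
                ∀ ℓ : PBond (F.P K) 0, dist1 (U ℓ * ((GaugeField.gaugeAct w U₀) ℓ)⁻¹) ≤ δ) →
            (⨅ w : {w : Site (F.P K) 0 → Matrix.specialUnitaryGroup (Fin 2) ℂ |
                ∀ U : GaugeField (F.P K) 0 (Matrix.specialUnitaryGroup (Fin 2) ℂ),
                  descendTo F ℰp J K hJK.le (GaugeField.gaugeAct w U) = descendTo F ℰp J K hJK.le U},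
              ∑ ℓ : PBond (F.P K) 0,
                dist1 (U ℓ * ((GaugeField.gaugeAct (w : Site (F.P K) 0 → Matrix.specialUnitaryGroup (Fin 2) ℂ) U₀) ℓ)⁻¹) ^ 2) ≤ r →
            c * (⨅ w : {w : Site (F.P K) 0 → Matrix.specialUnitaryGroup (Fin 2) ℂ |
                ∀ U : GaugeField (F.P K) 0 (Matrix.specialUnitaryGroup (Fin 2) ℂ),
                  descendTo F ℰp J K hJK.le (GaugeField.gaugeAct w U) = descendTo F ℰp J K hJK.le U},
              ∑ ℓ : PBond (F.P K) 0,
                dist1 (U ℓ * ((GaugeField.gaugeAct (w : Site (F.P K) 0 → Matrix.specialUnitaryGroup (Fin 2) ℂ) U₀) ℓ)⁻¹) ^ 2)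
              ≤ wilsonAction4 U - minActionRegPr F J K hJK.le ε₀ V := by
  obtain ⟨e₈, he₈, H⟩ := growthOn_nhds_at_isCritR2_of_lift_five L h5
  refine ⟨e₈, he₈, ?_⟩
  intro F hF J K hJK e γ b₀ p₀ ε₀ V U₀ δ he heε hU₀reg hcrit hmin hcont hlift ρ₀ Kπ hρ₀ hKπ hLip
  obtain ⟨N, hN, c, hc, hgrowN⟩ := H F hF J K hJK e γ b₀ p₀ ε₀ V U₀ he heε hU₀reg hcrit hmin hcont hlift ρ₀ Kπ hρ₀ hKπ hLip
  exact posCollar_of_growthOn_nhds F hJK.le V U₀ δ hN hc hgrowN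

/-- ★★★ **TUBE♭(V,U₀) AT PRINT'S REGULAR MINIMISER OVER AN IRREDUCIBLE DATUM ⟸ {IRR(V), (Lπ)_loc, ISOL∘(δ)}** — ✓(T4) §1 `tubeGrowth_of_growthOn_nhds_of_isolated` ∘
`growthOn_nhds_at_isCritR2_of_lift_five` (ISOL∘(δ) = the `hisol` text of ✓px8 `tubeGrowth_of_pos_of_isolated` ∕ (T3) :111–121 VERBATIM; at a datum with central stabiliser it is
✓∕⧗px8 `isol_of_atMostOneCriticalOrbit` ∘ ✓pen 4 `atMostOneCriticalOrbit_of_centralStab_five` modulo its regime letter).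
[cite: Balaban1985Variational, Thm 1 (8)-(10) p.279, (141)-(143) p.299; Balaban1985UV3, (12)-(13) p.259 and (18)-(22) p.260; Balaban1985Averaging, Prop. 5 (157) p.42] -/
theorem tubeGrowth_at_isCritR2_of_lift_of_isolated_five (L : ℕ) (h5 : 5 ≤ L) :
    ∃ e₈ : ℝ, 0 < e₈ ∧
      ∀ (F : T3Family), F.L = L → ∀ (J K : ℕ) (hJK : J < K) (e γ b₀ p₀ ε₀ : ℝ)
        (V : GaugeField (F.P J) 0 (Matrix.specialUnitaryGroup (Fin 2) ℂ)) (U₀ : GaugeField (F.P K) 0 (Matrix.specialUnitaryGroup (Fin 2) ℂ)) (δ : ℝ),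
        0 < e → e ≤ e₈ → U₀ ∈ regFibrePr F J K hJK.le e V → IsCritR2 F J K hJK.le V U₀ →
        wilsonAction4 U₀ = minActionRegPr F J K hJK.le ε₀ V →
        (∀ᶠ W in 𝓝 U₀, ContinuousAt (descendTo F ℰp J K hJK.le) W) →
        (∀ s : GaugeTransf (F.P J) 0 (Matrix.specialUnitaryGroup (Fin 2) ℂ), GaugeField.gaugeAct s V = V →
            ∃ k : GaugeTransf (F.P K) 0 (Matrix.specialUnitaryGroup (Fin 2) ℂ), GaugeField.gaugeAct k U₀ = U₀ ∧ descTransf F J K hJK.le k = s) →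
        ∀ (ρ₀ Kπ : ℝ), 0 < ρ₀ → 0 ≤ Kπ →
        (∀ (B : GaugeField (F.P K) 0 (Matrix.specialUnitaryGroup (Fin 2) ℂ)) (ρ : ℝ), 0 ≤ ρ → ρ ≤ ρ₀ →
          (∀ ℓ : PBond (F.P K) 0, ‖(U₀ ℓ : Matrix (Fin 2) (Fin 2) ℂ) - (B ℓ : Matrix (Fin 2) (Fin 2) ℂ)‖ ≤ ρ) →
          ∀ b : PBond (F.P J) 0,
            ‖((descendTo F ℰp J K hJK.le U₀ b : Matrix.specialUnitaryGroup (Fin 2) ℂ) : Matrix (Fin 2) (Fin 2) ℂ) -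
                ((descendTo F ℰp J K hJK.le B b : Matrix.specialUnitaryGroup (Fin 2) ℂ) : Matrix (Fin 2) (Fin 2) ℂ)‖ ≤ Kπ * ρ) →
        (∀ U ∈ closure (fibre F ℰp J K hJK.le V ∩ histGood F ℰp (θBal F.L γ b₀ p₀) K J),
            (∃ w : Site (F.P K) 0 → Matrix.specialUnitaryGroup (Fin 2) ℂ,
              (∀ U'' : GaugeField (F.P K) 0 (Matrix.specialUnitaryGroup (Fin 2) ℂ),
                  descendTo F ℰp J K hJK.le (GaugeField.gaugeAct w U'') = descendTo F ℰp J K hJK.le U'') ∧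
                ∀ ℓ : PBond (F.P K) 0, dist1 (U ℓ * ((GaugeField.gaugeAct w U₀) ℓ)⁻¹) ≤ δ) →
            wilsonAction4 U ≤ minActionRegPr F J K hJK.le ε₀ V →
            (⨅ w : {w : Site (F.P K) 0 → Matrix.specialUnitaryGroup (Fin 2) ℂ |
                ∀ U : GaugeField (F.P K) 0 (Matrix.specialUnitaryGroup (Fin 2) ℂ),
                  descendTo F ℰp J K hJK.le (GaugeField.gaugeAct w U) = descendTo F ℰp J K hJK.le U},
              ∑ ℓ : PBond (F.P K) 0,
                dist1 (U ℓ * ((GaugeField.gaugeAct (w : Site (F.P K) 0 → Matrix.specialUnitaryGroup (Fin 2) ℂ) U₀) ℓ)⁻¹) ^ 2) = 0) →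
        ∃ μ : ℝ, 0 < μ ∧ ∀ U ∈ fibre F ℰp J K hJK.le V, U ∈ histGood F ℰp (θBal F.L γ b₀ p₀) K J →
          (∃ w : Site (F.P K) 0 → Matrix.specialUnitaryGroup (Fin 2) ℂ,
            (∀ U'' : GaugeField (F.P K) 0 (Matrix.specialUnitaryGroup (Fin 2) ℂ),
                descendTo F ℰp J K hJK.le (GaugeField.gaugeAct w U'') = descendTo F ℰp J K hJK.le U'') ∧
              ∀ ℓ : PBond (F.P K) 0, dist1 (U ℓ * ((GaugeField.gaugeAct w U₀) ℓ)⁻¹) ≤ δ) →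
          μ * ((F.L : ℝ)⁻¹) ^ (2 * (K - J)) *
              (⨅ w : {w : Site (F.P K) 0 → Matrix.specialUnitaryGroup (Fin 2) ℂ |
                  ∀ U : GaugeField (F.P K) 0 (Matrix.specialUnitaryGroup (Fin 2) ℂ),
                    descendTo F ℰp J K hJK.le (GaugeField.gaugeAct w U) = descendTo F ℰp J K hJK.le U},
                ∑ ℓ : PBond (F.P K) 0,
                  dist1 (U ℓ * ((GaugeField.gaugeAct (w : Site (F.P K) 0 → Matrix.specialUnitaryGroup (Fin 2) ℂ) U₀) ℓ)⁻¹) ^ 2)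
            ≤ wilsonAction4 U - minActionRegPr F J K hJK.le ε₀ V := by
  obtain ⟨e₈, he₈, H⟩ := growthOn_nhds_at_isCritR2_of_lift_five L h5
  refine ⟨e₈, he₈, ?_⟩
  intro F hF J K hJK e γ b₀ p₀ ε₀ V U₀ δ he heε hU₀reg hcrit hmin hcont hlift ρ₀ Kπ hρ₀ hKπ hLip hisol
  obtain ⟨N, hN, c, hc, hgrowN⟩ := H F hF J K hJK e γ b₀ p₀ ε₀ V U₀ he heε hU₀reg hcrit hmin hcont hlift ρ₀ Kπ hρ₀ hKπ hLip
  exact tubeGrowth_of_growthOn_nhds_of_isolated F hJK.le V U₀ δ hN hc hgrowN hisol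

end Assembly


end Summit.QuantumFields.YangMills.Theorems.FluctuationComparisonRegPrIntLS2BetaPosCollarOfStabiliserLift

end
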